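import Summits.BirchSwinnertonDyer.BirchSwinnertonDyer.Theorems.ResidualThetaTransportAtTwoSignedMuSeedAtTwoPlusEvenSymplecticFreeParity
import HarnessLib

/-!
# Seed crux `SignedMuSeedAtTwoPlus` (stmt-BirchSwinnertonDyer-21438), line `ct-involution-parity`:
# the free-parity law in grades `k ≥ 2` needs NO evenness; the two-layer identity behind evenness

Cell `bsd-wall`, width seat `bsd-wall-rtt-p4-w2` g9 (sequel to `…EvenSymplecticFreeParity.lean`, p651662, which
proves stub S1 `EvenSymplecticFreeParity` verbatim).  HONEST FRAMING: THEOREMS ONLY — no definition, no named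
fact, no instance, no `sorry`; pure algebra, no number theory imported; closes no item; BSD is NOT proved by this.

## What is proved (same notation: `A` finite abelian, `g^(2^n) = 1`, `n ≥ 1`, `B : A × A → ℚ/ℤ` left-nondegenerate,
## alternating, `g`-invariant; `N = ∑_{i<2^n} gⁱ`, `U_k = 2^(k-1) A ∩ A[2]`, `m_k = log₂ #(N(U_k)+U_{k+1}) − log₂ #U_{k+1}`)

* `even_log_card_map_normSum_sup_sub_log_card_of_nsmul_even` — the law in grade `k = j+1` under the GRADED evenness
  hypothesis `B(2^j x, g₀ x) = 0` only (`g₀ = g^(2^(n-1))`); same proof as the parent file's §4 (the involution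
  term of the norm form on `P = A[2^k]` is `B(2^j a, g₀ a)`).
* `two_nsmul_apply_involution_eq_zero` — for ANY alternating `τ`-invariant pairing and involution `τ`:
  `2 • B(x, τ x) = 0` (`B(x, τx) = B(τx, τ²x) = B(τx, x) = −B(x, τx)`).  Hence
* **`even_log_card_map_normSum_sup_sub_log_card_of_one_le` — in every grade `k ≥ 2` the free multiplicity `m_k` is
  even for EVERY nondegenerate alternating `g`-invariant pairing, with NO evenness hypothesis**: the line card's remark
  «for `k ≥ 2` alternation suffices; at `k = 1` evenness is indispensable — `𝔽₂[C_{2^n}]` itself IS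
  symplectic-invariant» made a theorem.  Reading for the line: the Cassels–Tate input S2 is needed in its EVEN form
  only against a `μ`-summand `Λ/2` (grade 1); against `Λ/2^k`, `k ≥ 2`, alternation + `G_n`-invariance of the pairing
  on `Ш(W/ℚ_n)/div` already force even multiplicity.
* `apply_involution_self_eq_zero_of_corestriction` — the TWO-LAYER IDENTITY that is the whole content of evenness in
  S2, as abstract algebra: if `res ∘ cor = 1 + g₀` and `⟨res a, y⟩_n = ⟨a, cor y⟩_{n-1}` with `⟨·,·⟩_{n-1}` alternating
  and `⟨·,·⟩_n` alternating, then `⟨g₀ x, x⟩_n = ⟨cor x, cor x⟩_{n-1} − ⟨x, x⟩_n = 0`.  (What S2 must supply from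
  print is exactly: Cassels–Tate is alternating at both layers, Galois-equivariant, and `res`/`cor`-adjoint.)
[folklore]
-/

noncomputable section

set_option autoImplicit false
set_option linter.dupNamespace false

open Finset
open Literature.GroupTheory.FiniteAbelian

namespace Summit.BirchSwinnertonDyer.BirchSwinnertonDyer.Theorems.SignedMuAtTwo.EvenSymplecticFreeParity

variable {A : Type*} [AddCommGroup A]

/-! ### §1 The law under graded evenness `B(2^j x, g₀ x) = 0` -/

/-- **Free-parity law in grade `j+1` under graded evenness** `B (2^j • x) (g₀ x) = 0` (`g₀ = g^(2^(n-1))`); for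
`j = 0` this is the parent file's theorem, for `j ≥ 1` the hypothesis is automatic (§2). [folklore] -/
theorem even_log_card_map_normSum_sup_sub_log_card_of_nsmul_even [Finite A] (g : AddMonoid.End A)
    (B : A →+ A →+ AddCircle (1 : ℚ)) {n : ℕ} (hn : 1 ≤ n) (hg : g ^ (2 ^ n) = 1)
    (hnd : ∀ x, (∀ y, B x y = 0) → x = 0) (halt : ∀ x, B x x = 0)
    (hinv : ∀ x y, B (g x) (g y) = B x y) (j : ℕ)
    (heven : ∀ x, B ((2 ^ j) • x) ((g ^ (2 ^ (n - 1))) x) = 0) :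
    Even (Nat.log 2 (Nat.card ↥((((2 ^ j) • AddMonoidHom.id A).range ⊓ AddSubgroup.torsionBy A 2).map
        (∑ i ∈ Finset.range (2 ^ n), (g ^ i : AddMonoid.End A)) ⊔
        (((2 ^ (j + 1)) • AddMonoidHom.id A).range ⊓ AddSubgroup.torsionBy A 2))) -
      Nat.log 2 (Nat.card ↥(((2 ^ (j + 1)) • AddMonoidHom.id A).range ⊓ AddSubgroup.torsionBy A 2))) := by
  -- notation
  set N : A →+ A := ∑ i ∈ Finset.range (2 ^ n), (g ^ i : AddMonoid.End A) with hN
  set T₂ : AddSubgroup A := AddSubgroup.torsionBy A 2 with hT₂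
  set U : AddSubgroup A := ((2 ^ j) • AddMonoidHom.id A).range ⊓ T₂ with hU
  set U' : AddSubgroup A := ((2 ^ (j + 1)) • AddMonoidHom.id A).range ⊓ T₂ with hU'
  set V : AddSubgroup A := U.map N ⊔ U' with hV
  set P : AddSubgroup A := AddSubgroup.torsionBy A ((2 ^ (j + 1) : ℕ) : ℤ) with hP
  -- elementary membership facts
  have hNapply : ∀ y, N y = ∑ i ∈ Finset.range (2 ^ n), (g ^ i) y := fun y ↦ normSum_apply g _ y
  have memT₂ : ∀ x, x ∈ T₂ ↔ (2 : ℕ) • x = 0 := fun x ↦ by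
    rw [hT₂, show (2 : ℤ) = ((2 : ℕ) : ℤ) from rfl]
    exact AddSubgroup.torsionBy.nsmul_iff
  have memP : ∀ x, x ∈ P ↔ 2 ^ (j + 1) • x = 0 := fun x ↦ AddSubgroup.torsionBy.nsmul_iff
  have memRange : ∀ (c : ℕ) (x : A), x ∈ (c • AddMonoidHom.id A).range ↔ ∃ a, c • a = x :=
    fun c x ↦ by simp only [AddMonoidHom.mem_range, AddMonoidHom.nsmul_apply, AddMonoidHom.id_apply]
  have hU_eq : U = P.map ((2 ^ j) • AddMonoidHom.id A) := by
    ext x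
    rw [hU, AddSubgroup.mem_inf, memRange, memT₂, AddSubgroup.mem_map]
    constructor
    · rintro ⟨⟨a, rfl⟩, h2⟩
      exact ⟨a, (memP a).mpr (by rwa [pow_succ, mul_nsmul]), rfl⟩
    · rintro ⟨a, ha, rfl⟩
      refine ⟨⟨a, rfl⟩, ?_⟩
      rwa [AddMonoidHom.nsmul_apply, AddMonoidHom.id_apply, ← mul_nsmul, ← pow_succ, ← memP]
  -- the comparison map `θ : P → A/U'`, `a ↦ N(2^j a)`
  let θ : ↥P →+ A ⧸ U' :=
    (QuotientAddGroup.mk' U').comp ((N.comp ((2 ^ j) • AddMonoidHom.id A)).comp P.subtype)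
  have hθ : ∀ a : ↥P, θ a = QuotientAddGroup.mk (N ((2 ^ j) • (a : A))) := fun _ ↦ rfl
  have hθrange : θ.range = (U.map N).map (QuotientAddGroup.mk' U') := by
    change ((QuotientAddGroup.mk' U').comp ((N.comp ((2 ^ j) • AddMonoidHom.id A)).comp
      P.subtype)).range = _
    rw [← AddMonoidHom.map_range, ← AddMonoidHom.map_range, AddSubgroup.range_subtype,
      ← AddSubgroup.map_map, ← hU_eq]
  have hVcomap : (θ.range).comap (QuotientAddGroup.mk' U') = V := by
    rw [hθrange, AddSubgroup.comap_map_eq, QuotientAddGroup.ker_mk']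
  have hVindex : V.index = θ.range.index :=
    hVcomap ▸ θ.range.index_comap_of_surjective (QuotientAddGroup.mk'_surjective U')
  have hcardV : Nat.card V = Nat.card θ.range * Nat.card U' := by
    have h1 := AddSubgroup.card_mul_index V
    have h2 := AddSubgroup.card_mul_index θ.range
    have h3 := AddSubgroup.card_eq_card_quotient_mul_card_addSubgroup U'
    have hne : V.index ≠ 0 := AddSubgroup.index_ne_zero_of_finite
    rw [hVindex] at h1 hne
    have : Nat.card V * θ.range.index = Nat.card θ.range * Nat.card U' * θ.range.index := by
      rw [h1, h3, ← h2]; ring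
    exact Nat.eq_of_mul_eq_mul_right (Nat.pos_of_ne_zero hne) this
  -- the alternating form `F(a, b) = B(a, 2^j N b)` on `P`, and its radical `θ.ker`
  let F : ↥P →+ ↥P →+ AddCircle (1 : ℚ) :=
    (B.comp P.subtype).compl₂ ((((2 ^ j) • AddMonoidHom.id A).comp N).comp P.subtype)
  have hF : ∀ a b : ↥P, F a b = B (a : A) ((2 ^ j) • N (b : A)) := fun _ _ ↦ rfl
  have hF' : ∀ a b : ↥P, F a b = B (N ((2 ^ j) • (a : A))) (b : A) := by
    intro a b
    rw [hF, map_nsmul, ← AddMonoidHom.nsmul_apply, ← map_nsmul, apply_normSum_eq B g hinv hg N hNapply]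
  have hm : 2 ^ n = 2 * 2 ^ (n - 1) := by rw [← pow_succ', Nat.sub_add_cancel hn]
  have haltF : ∀ a : ↥P, F a a = 0 := by
    intro a
    rw [hF, map_nsmul, ← AddMonoidHom.nsmul_apply, ← map_nsmul, hNapply, map_sum]
    -- the form `b(x, y) = B(2^j x, y)`
    have key := sum_apply_pow_self_eq_zero (B.comp ((2 ^ j) • AddMonoidHom.id A)) g
      (fun x ↦ by
        rw [AddMonoidHom.comp_apply, AddMonoidHom.nsmul_apply, AddMonoidHom.id_apply, map_nsmul,
          AddMonoidHom.nsmul_apply, halt, smul_zero])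
      (fun x y ↦ by
        rw [AddMonoidHom.comp_apply, AddMonoidHom.comp_apply, AddMonoidHom.nsmul_apply,
          AddMonoidHom.nsmul_apply, AddMonoidHom.id_apply, AddMonoidHom.id_apply, ← map_nsmul, hinv])
      (h := 2 ^ (n - 1)) (by rw [← hm]; exact hg)
      (fun x ↦ by rw [AddMonoidHom.comp_apply, AddMonoidHom.nsmul_apply, AddMonoidHom.id_apply, heven])
      (a : A)
    rw [← hm] at key
    simpa only [AddMonoidHom.comp_apply, AddMonoidHom.nsmul_apply, AddMonoidHom.id_apply] using key
  have hker : ∀ a : ↥P, a ∈ θ.ker ↔ ∃ c : A, 2 ^ (j + 1) • c = N ((2 ^ j) • (a : A)) := by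
    intro a
    rw [AddMonoidHom.mem_ker, hθ, QuotientAddGroup.eq_zero_iff, hU', AddSubgroup.mem_inf, memRange,
      memT₂]
    refine ⟨fun h ↦ h.1, fun h ↦ ⟨h, ?_⟩⟩
    rw [← map_nsmul, ← mul_nsmul, ← pow_succ, (memP _).mp a.2, map_zero]
  have hradF : ∀ a : ↥P, a ∈ θ.ker ↔ ∀ b : ↥P, F a b = 0 := by
    intro a
    rw [hker]
    constructor
    · rintro ⟨c, hc⟩ b
      rw [hF', ← hc, map_nsmul, AddMonoidHom.nsmul_apply, ← map_nsmul, (memP _).mp b.2, map_zero]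
    · intro h
      refine exists_nsmul_eq_of_forall_apply_eq_zero B hnd (2 ^ (j + 1)) fun y hy ↦ ?_
      have := h ⟨y, (memP y).mpr hy⟩
      rwa [hF'] at this
  have h2F : ∀ a : ↥P, (2 : ℕ) • a ∈ θ.ker := fun a ↦ (hker _).mpr ⟨0, by
    rw [AddSubgroup.coe_nsmul, ← mul_nsmul, ← pow_succ', (memP _).mp a.2, map_zero, smul_zero]⟩
  obtain ⟨m, hm2⟩ := exists_index_eq_pow_two_mul F haltF θ.ker hradF h2F
  -- `#U'` is a power of `2`
  haveI : Fact (Nat.Prime 2) := ⟨Nat.prime_two⟩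
  letI : Module (ZMod 2) ↥U' := AddCommGroup.zmodModule (fun x ↦ Subtype.ext (by
    rw [AddSubgroup.coe_nsmul, AddSubgroup.coe_zero]
    exact (memT₂ _).mp (AddSubgroup.mem_inf.mp x.2).2))
  have hcardU' : Nat.card ↥U' = 2 ^ Module.finrank (ZMod 2) ↥U' := (pow_finrank_eq_natCard 2 ↥U').symm
  -- conclusion
  have hcardV' : Nat.card V = 2 ^ (2 * m + Module.finrank (ZMod 2) ↥U') := by
    rw [hcardV, ← AddSubgroup.index_ker, hm2, hcardU', ← pow_add]
  rw [hcardV', hcardU', Nat.log_pow Nat.one_lt_two, Nat.log_pow Nat.one_lt_two, Nat.add_sub_cancel]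
  exact even_two_mul m

/-! ### §2 Grades `k ≥ 2`: no evenness needed -/

/-- For an alternating pairing invariant under an involution `τ`: `2 • B x (τ x) = 0`
(`B(x, τx) = B(τx, τ²x) = B(τx, x) = −B(x, τx)`). [folklore] -/
theorem two_nsmul_apply_involution_eq_zero {Q : Type*} [AddCommGroup Q] (B : A →+ A →+ Q)
    (halt : ∀ x, B x x = 0) (τ : AddMonoid.End A) (hinv : ∀ x y, B (τ x) (τ y) = B x y)
    (hτ : ∀ x, τ (τ x) = x) (x : A) : 2 • B x (τ x) = 0 := by
  have h : B x (τ x) = -B x (τ x) := by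
    conv_lhs => rw [← hinv x (τ x), hτ, eq_neg_of_alternating B halt (τ x) x]
  rw [two_nsmul]
  nth_rw 1 [h]
  exact neg_add_cancel _

/-- **Free-parity law in every grade `k = j + 1 ≥ 2`, WITHOUT evenness.** For a finite abelian group `A`,
`g ∈ End A` with `g^(2^n) = 1` (`n ≥ 1`) and ANY left-nondegenerate alternating `g`-invariant `ℚ/ℤ`-pairing:
`log₂ #(N(U) + U') − log₂ #U'` is even for `U = 2^j A ∩ A[2]`, `U' = 2^(j+1) A ∩ A[2]`, `j ≥ 1`
(graded evenness `B(2^j x, g₀ x) = 2^(j-1) • (2 • B(x, g₀ x)) = 0` is automatic). [folklore] -/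
theorem even_log_card_map_normSum_sup_sub_log_card_of_one_le [Finite A] (g : AddMonoid.End A)
    (B : A →+ A →+ AddCircle (1 : ℚ)) {n : ℕ} (hn : 1 ≤ n) (hg : g ^ (2 ^ n) = 1)
    (hnd : ∀ x, (∀ y, B x y = 0) → x = 0) (halt : ∀ x, B x x = 0)
    (hinv : ∀ x y, B (g x) (g y) = B x y) {j : ℕ} (hj : 1 ≤ j) :
    Even (Nat.log 2 (Nat.card ↥((((2 ^ j) • AddMonoidHom.id A).range ⊓ AddSubgroup.torsionBy A 2).map
        (∑ i ∈ Finset.range (2 ^ n), (g ^ i : AddMonoid.End A)) ⊔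
        (((2 ^ (j + 1)) • AddMonoidHom.id A).range ⊓ AddSubgroup.torsionBy A 2))) -
      Nat.log 2 (Nat.card ↥(((2 ^ (j + 1)) • AddMonoidHom.id A).range ⊓ AddSubgroup.torsionBy A 2))) := by
  refine even_log_card_map_normSum_sup_sub_log_card_of_nsmul_even g B hn hg hnd halt hinv j fun x ↦ ?_
  have hτ : ∀ x, (g ^ (2 ^ (n - 1))) ((g ^ (2 ^ (n - 1))) x) = x := fun x ↦ by
    rw [← Function.comp_apply (f := ⇑(g ^ (2 ^ (n - 1)))), ← AddMonoid.End.coe_mul, ← pow_add,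
      ← two_mul, ← pow_succ', Nat.sub_add_cancel hn, hg, AddMonoid.End.coe_one, id]
  obtain ⟨j', rfl⟩ : ∃ j', j = j' + 1 := ⟨j - 1, (Nat.sub_add_cancel hj).symm⟩
  rw [map_nsmul, AddMonoidHom.nsmul_apply, pow_succ, mul_nsmul',
    two_nsmul_apply_involution_eq_zero B halt _ (apply_pow_apply_pow B g hinv _) hτ, smul_zero]

/-! ### §3 The two-layer identity behind evenness (abstract form of S2's `⟨g₀ x, x⟩ = ⟨cor x, cor x⟩ = 0`) -/

/-- **Two-layer identity.** Abelian groups `M` ("layer `n`") and `M'` ("layer `n-1`") with pairings `Bn`, `Bm`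
into `Q`, maps `res : M' → M`, `cor : M → M'` and `g₀ ∈ End M` with `res (cor x) = x + g₀ x` and the adjunction
`Bn (res a) y = Bm a (cor y)`: if `Bn` and `Bm` are alternating then `Bn (g₀ x) x = 0` — the pairing at layer `n`
is EVEN at the involution.  (For Cassels–Tate on `Ш(W/ℚ_n)`, `Ш(W/ℚ_{n-1})`: `res ∘ cor = N_{ℚ_n/ℚ_{n-1}} = 1 + g₀`.)
[folklore] -/
theorem apply_involution_self_eq_zero_of_corestriction {M M' Q : Type*} [AddCommGroup M] [AddCommGroup M']
    [AddCommGroup Q] (Bn : M →+ M →+ Q) (Bm : M' →+ M' →+ Q) (res : M' →+ M) (cor : M →+ M')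
    (g₀ : AddMonoid.End M) (hrc : ∀ x, res (cor x) = x + g₀ x) (hadj : ∀ a y, Bn (res a) y = Bm a (cor y))
    (haltn : ∀ x, Bn x x = 0) (haltm : ∀ a, Bm a a = 0) (x : M) : Bn (g₀ x) x = 0 := by
  have h : Bn (res (cor x)) x = Bn x x + Bn (g₀ x) x := by rw [hrc, map_add, AddMonoidHom.add_apply]
  rw [hadj, haltm, haltn, zero_add] at h
  exact h.symm

end Summit.BirchSwinnertonDyer.BirchSwinnertonDyer.Theorems.SignedMuAtTwo.EvenSymplecticFreeParity

end
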